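import Literature.Analysis.FluidPDE.TaoEnstrophyExteriorOfNonlinearEstimate
import HarnessLib

/-!
# Tao (2011/2013), Thm. 10.1 (exterior form) at unit viscosity, as printed, from the single
# remaining named fact `tao2011_nonlinearEstimate`

`Literature.Analysis.FluidPDE.tao2011_enstrophyLocalisation_exterior_unit` (`TaoUnitViscosity.lean`;
Tao 2011, arXiv:1108.1165, Thm. 10.1 = arXiv Thm. 59 in the exterior form of Remark 10.6 =
arXiv Rem. 64, `ν = 1` as printed, `f = 0`) is the `ν := 1` instance of the tree's `ν > 0` form
`tao2011_enstrophyLocalisation_exterior` (`tao2011_enstrophyLocalisation_exterior_unit_of`). With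
Prop. 9.1 (`tao2011_boundedTotalSpeed_holds`, `TaoBoundedTotalSpeedProofs.lean`) and Lemma 8.1
(`tao_finite_energy_smooth_energy_bound_holds`) theorems of the tree, the `ν > 0` form rests on the
§10 nonlinear estimate alone (`tao2011_enstrophyLocalisation_exterior_of_nonlinearEstimate`,
`TaoEnstrophyExteriorOfNonlinearEstimate.lean`); this file records the same for the printed
unit-viscosity statement:

* `tao2011_enstrophyLocalisation_exterior_unit_of_nonlinearEstimate :
    tao2011_nonlinearEstimate → tao2011_enstrophyLocalisation_exterior_unit`.

Discharging `tao2011_nonlinearEstimate` (the estimate (10.19)–(10.23) for `Y₆`: Whitney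
decomposition, local Biot–Savart law, Sobolev/Poincaré on balls, parent-ball chaining) turns this
into `tao2011_enstrophyLocalisation_exterior_unit_holds`. No statement is modified and no definition
is introduced.

## Mathlib / tree search

`lean search 'exterior_unit_of_nonlinearEstimate' --decl`: only the two-leaf forms
`…_unit_of_nonlinearEstimate_of_almostRegular`, `…_of_leray` (`TaoEnstrophyLocalisationLeaves`).
Reused: `tao2011_enstrophyLocalisation_exterior_unit_of` (`TaoUnitViscosity`),
`tao2011_enstrophyLocalisation_exterior_of_nonlinearEstimate`.

## References

* T. Tao, *Localisation and compactness properties of the Navier–Stokes global regularity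
  problem*, Anal. PDE 6 (2013) 25–107 = arXiv:1108.1165 (`Tao2011`): Thm. 10.1 and Remark 10.6
  (arXiv Thm. 59, Rem. 64, pp. 30–33), footnote 3 (p. 4, `ν = 1`).
-/

noncomputable section

namespace Literature.Analysis.FluidPDE

/-- **Tao 2011, Thm. 10.1 (exterior form of Remark 10.6) at unit viscosity, as printed, from the
§10 nonlinear estimate for `Y₆` alone** (Prop. 9.1 and Lemma 8.1 being theorems of the tree). [cite: Tao2011, Thm. 10.1 + Remark 10.6] -/
theorem tao2011_enstrophyLocalisation_exterior_unit_of_nonlinearEstimate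
    (hY : tao2011_nonlinearEstimate) : tao2011_enstrophyLocalisation_exterior_unit :=
  tao2011_enstrophyLocalisation_exterior_unit_of
    (tao2011_enstrophyLocalisation_exterior_of_nonlinearEstimate hY)

end Literature.Analysis.FluidPDE

end
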